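import Mathlib
import Literature.Analysis.FunctionSpaces.TorusTrigPoly
import Literature.Analysis.FunctionSpaces.TorusFourierModes
import Literature.Analysis.FunctionSpaces.TorusCalculusProofs
import Literature.Analysis.FunctionSpaces.TorusAxisAverage
import Summits.AnomalousDissipation.AnomalousDissipation.Theorems.TaylorCertificatesPacketLemmaBernstein
import Summits.AnomalousDissipation.AnomalousDissipation.Theorems.TaylorCertificatesPacketLemmaFejer
import Summits.AnomalousDissipation.AnomalousDissipation.Theorems.TaylorCertificatesPacketLemmaSpectrum
import HarnessLib

/-!
# Route TaylorCertificates — `PacketLemma`, helper 5: the strain form of a band-limited field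

For the proof of
`Summit.AnomalousDissipation.AnomalousDissipation.Theses.TaylorCertificates.PacketLemma`
(item stmt-AnomalousDissipation-14032). For a real vector trigonometric polynomial
`W = realTrigPoly S Ŵ` on `T^d` and a direction `b ∈ ℝ^d`, the **strain form**
`g_b(x) = ⟪b, DW(x) b⟫ = ⟪b, convect (fun _ ↦ b) W x⟫` is the scalar trigonometric polynomial
`Re ∑_{k∈S} e_k(x) Γ_k`, `Γ_k = ⟪b, (2πi k·b) Ŵ_k⟫_ℂ` (`inner_convect_const_realTrigPoly`). Hence:

* along each coordinate circle it is a one-variable trigonometric polynomial of degree `≤ D` when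
  `S ⊆ Ω_D`, and the Bernstein–Szegő difference inequality (`abs_sub_le_of_trigSum`) gives
  `|g(y + u eᵢ) - g(y)| ≤ D B |1 - e_1(u)|` whenever `|g| ≤ B` (`abs_sub_le_coord_of_re_trigPoly`);
  telescoping over the coordinates, `|g(x) - g(x₀)| ≤ D B ∑ᵢ |1 - e_1(xᵢ - x₀ᵢ)|`
  (`abs_sub_le_sum_of_re_trigPoly`);
* the **kernel estimate** (`integral_mul_le_of_windows`): for a continuous weight `K ≥ 0`
  concentrated at `x₀` in the sense `∫ K |1-e_1(xᵢ-x₀ᵢ)|²/4 ≤ ε² ∫ K`, every `g` with the above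
  modulus of continuity has `∫ K g ≤ g(x₀) ∫ K + 2 |d| L ε ∫ K` (pointwise AM–GM, no
  Cauchy–Schwarz needed);
* polarisation bounds for a linear map whose quadratic form is bounded on the unit sphere
  (`abs_inner_add_inner_le`, `inner_self_le_of_unit_bound`).

No definitions, no named facts.
-/

noncomputable section

open MeasureTheory UnitAddTorus Complex Real
open scoped ComplexConjugate

namespace Summit.AnomalousDissipation.AnomalousDissipation.Theorems

-- the mandated namespace `Summit.<Summit>.<Problem>.Theorems` repeats `AnomalousDissipation` (single-problem summit)
set_option linter.dupNamespace false

open Literature.Analysis.FunctionSpaces Literature.Analysis.FunctionSpaces.Torus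

variable {d : Type*} [Fintype d] [DecidableEq d]

/-! ### The strain form of a real trigonometric polynomial is a scalar trigonometric polynomial -/

omit [DecidableEq d] in
/-- Real scalars pass through `realTrigPoly`: `realTrigPoly S ((r : ℂ) • c) x = r • realTrigPoly S c x`. [folklore] -/
theorem realTrigPoly_real_smul (S : Finset (d → ℤ)) (r : ℝ) (c : (d → ℤ) → EuclideanSpace ℂ d)
    (x : UnitAddTorus d) : realTrigPoly S ((r : ℂ) • c) x = r • realTrigPoly S c x := by
  rw [realTrigPoly_apply, realTrigPoly_apply, trigPoly_smul, Pi.smul_apply, Complex.coe_smul,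
    ContinuousLinearMap.map_smul]

/-- **The directional derivative of a real trigonometric polynomial along a constant field**:
`convect (fun _ ↦ b) (realTrigPoly S c) x = realTrigPoly S (k ↦ (2πi k·b) • c k) x`. [folklore] -/
theorem convect_const_realTrigPoly (S : Finset (d → ℤ)) (c : (d → ℤ) → EuclideanSpace ℂ d)
    (b : EuclideanSpace ℝ d) (x : UnitAddTorus d) :
    convect (fun _ => b) (realTrigPoly S c) x =
      realTrigPoly S (fun k => (2 * π * Complex.I * ∑ j, (b j : ℂ) * (k j : ℂ)) • c k) x := by
  rw [convect, fderiv_apply_eq_sum_partialDeriv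
    ((isSmooth_realTrigPoly S c).isContDiff (n := 1) (mod_cast le_top)) x b]
  simp_rw [partialDeriv_realTrigPoly]
  have h : ∀ j, b j • realTrigPoly S (fun k => (2 * π * Complex.I * (k j : ℂ)) • c k) x =
      realTrigPoly S (fun k => ((b j : ℝ) : ℂ) • ((2 * π * Complex.I * (k j : ℂ)) • c k)) x := by
    intro j
    rw [← realTrigPoly_real_smul]
    rfl
  simp_rw [h]
  rw [realTrigPoly_apply, trigPoly_apply]
  simp_rw [realTrigPoly_apply, trigPoly_apply, ← map_sum]
  congr 1
  rw [Finset.sum_comm]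
  refine Finset.sum_congr rfl fun k _ => ?_
  rw [← Finset.smul_sum, Finset.mul_sum, Finset.sum_smul]
  refine congrArg _ (Finset.sum_congr rfl fun j _ => ?_)
  rw [smul_smul]
  congr 1
  ring

omit [DecidableEq d] in
/-- Real pairings with a real trigonometric polynomial are real parts of scalar ones:
`⟪b, realTrigPoly S c x⟫ = Re ∑_{k∈S} e_k(x) ⟪b, c k⟫_ℂ`. [folklore] -/
theorem inner_realTrigPoly_eq_re (S : Finset (d → ℤ)) (c : (d → ℤ) → EuclideanSpace ℂ d)
    (b : EuclideanSpace ℝ d) (x : UnitAddTorus d) :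
    inner ℝ b (realTrigPoly S c x) =
      (trigPoly S (fun k => inner ℂ (EuclideanSpace.complexify b) (c k)) x).re := by
  rw [realTrigPoly_apply, EuclideanSpace.inner_realPart_eq_re_inner, trigPoly_apply, trigPoly_apply,
    inner_sum]
  simp_rw [inner_smul_right, smul_eq_mul]

/-- **The strain form is a scalar trigonometric polynomial**: for `W = realTrigPoly S c`,
`⟪b, convect (fun _ ↦ b) W x⟫ = Re (trigPoly S Γ x)` with
`Γ_k = ⟪b, (2πi k·b) • c k⟫_ℂ`. [folklore] -/
theorem inner_convect_const_realTrigPoly (S : Finset (d → ℤ)) (c : (d → ℤ) → EuclideanSpace ℂ d)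
    (b : EuclideanSpace ℝ d) (x : UnitAddTorus d) :
    inner ℝ b (convect (fun _ => b) (realTrigPoly S c) x) =
      (trigPoly S (fun k => inner ℂ (EuclideanSpace.complexify b)
        ((2 * π * Complex.I * ∑ j, (b j : ℂ) * (k j : ℂ)) • c k)) x).re := by
  rw [convect_const_realTrigPoly, inner_realTrigPoly_eq_re]

/-! ### Restriction to coordinate circles and the Bernstein–Szegő modulus of continuity -/

/-- Along the `i`-th coordinate circle through `y`, a scalar trigonometric polynomial is a
one-variable trigonometric polynomial with frequencies `kᵢ`:
`trigPoly S Γ (y + t eᵢ) = ∑_{k∈S} (Γ_k e_k(y)) e^{2πi kᵢ t}`. [folklore] -/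
theorem trigPoly_add_single_coe (S : Finset (d → ℤ)) (Γ : (d → ℤ) → ℂ) (y : UnitAddTorus d)
    (i : d) (t : ℝ) :
    trigPoly S Γ (y + Pi.single i (t : UnitAddCircle)) =
      ∑ k ∈ S, (Γ k * mFourier k y) * Complex.exp (2 * π * Complex.I * (k i : ℤ) * t) := by
  rw [trigPoly_apply_scalar]
  refine Finset.sum_congr rfl fun k _ => ?_
  rw [mFourier_add_single, fourier_coe_apply, Complex.ofReal_one, div_one]
  ring

/-- **Bernstein–Szegő modulus of continuity along a coordinate**: if `g = Re ∘ trigPoly S Γ` with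
`S ⊆ Ω_D` and `|g| ≤ B`, then `|g(y + u eᵢ) - g(y)| ≤ D B |1 - e_1(u)|` for every `u` on the
circle (`abs_sub_le_of_trigSum` with `|1 - e_1(t)| = 2|sin πt|`). [folklore] -/
theorem abs_sub_le_coord_of_re_trigPoly {S : Finset (d → ℤ)} {D : ℕ} (hS : S ⊆ freqCube D)
    (Γ : (d → ℤ) → ℂ) {B : ℝ} (hB : ∀ x, |(trigPoly S Γ x).re| ≤ B) (y : UnitAddTorus d) (i : d)
    (u : UnitAddCircle) :
    |(trigPoly S Γ (y + Pi.single i u)).re - (trigPoly S Γ y).re| ≤ D * B * ‖(1 : ℂ) - fourier 1 u‖ := by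
  obtain ⟨t, rfl⟩ := QuotientAddGroup.mk_surjective u
  have hm : ∀ k ∈ S, ((fun k : d → ℤ => k i) k).natAbs ≤ D := by
    intro k hk
    have h := (mem_freqCube.1 (hS hk)) i
    show (k i).natAbs ≤ D
    omega
  have h := abs_sub_le_of_trigSum S (fun k : d → ℤ => k i) (fun k => Γ k * mFourier k y) hm
    (f := fun t : ℝ => (trigPoly S Γ (y + Pi.single i (t : UnitAddCircle))).re)
    (fun t => by simp only [trigPoly_add_single_coe]) (fun t => hB _) t 0
  simp only [QuotientAddGroup.mk_zero, Pi.single_zero, add_zero, sub_zero] at h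
  refine h.trans (le_of_eq ?_)
  rw [norm_one_sub_fourier_one_coe]
  ring

/-- **Telescoping over the coordinates**: with the same hypotheses,
`|g(x) - g(x₀)| ≤ D B ∑ᵢ |1 - e_1(xᵢ - x₀ᵢ)|`. [folklore] -/
theorem abs_sub_le_sum_of_re_trigPoly {S : Finset (d → ℤ)} {D : ℕ} (hS : S ⊆ freqCube D)
    (Γ : (d → ℤ) → ℂ) {B : ℝ} (hB : ∀ x, |(trigPoly S Γ x).re| ≤ B) (x₀ x : UnitAddTorus d) :
    |(trigPoly S Γ x).re - (trigPoly S Γ x₀).re| ≤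
      D * B * ∑ i, ‖(1 : ℂ) - fourier 1 (x i - x₀ i)‖ := by
  -- move from `x₀` to `x` one coordinate at a time through the points `j ↦ if j ∈ s then x j else x₀ j`
  have key : ∀ s : Finset d,
      |(trigPoly S Γ (fun j => if j ∈ s then x j else x₀ j)).re - (trigPoly S Γ x₀).re| ≤
        D * B * ∑ i ∈ s, ‖(1 : ℂ) - fourier 1 (x i - x₀ i)‖ := by
    intro s
    induction s using Finset.induction_on with
    | empty =>
        have h0 : (fun j => if j ∈ (∅ : Finset d) then x j else x₀ j) = x₀ := by
          funext j; simp
        rw [h0, sub_self, abs_zero, Finset.sum_empty, mul_zero]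
    | insert i s hi ih =>
        have hstep : (fun j => if j ∈ insert i s then x j else x₀ j) =
            (fun j => if j ∈ s then x j else x₀ j) + Pi.single i (x i - x₀ i) := by
          funext j
          simp only [Finset.mem_insert, Pi.add_apply]
          by_cases hji : j = i
          · subst hji; simp [hi]
          · simp [hji]
        rw [Finset.sum_insert hi, mul_add, hstep]
        have h1 := abs_sub_le_coord_of_re_trigPoly hS Γ hB (fun j => if j ∈ s then x j else x₀ j) i
          (x i - x₀ i)
        have h2 := abs_sub_le
          (trigPoly S Γ ((fun j => if j ∈ s then x j else x₀ j) + Pi.single i (x i - x₀ i))).re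
          (trigPoly S Γ (fun j => if j ∈ s then x j else x₀ j)).re (trigPoly S Γ x₀).re
        linarith
  have hx : (fun j => if j ∈ (Finset.univ : Finset d) then x j else x₀ j) = x := by funext j; simp
  have h := key Finset.univ
  rwa [hx] at h

/-! ### The kernel estimate -/

omit [DecidableEq d] in
/-- **Kernel estimate.** Let `K ≥ 0` be a continuous weight on `T^d`, concentrated at `x₀` in the
sense `∫ K(x) |1 - e_1(xᵢ - x₀ᵢ)|²/4 dx ≤ ε² ∫ K` for each coordinate, and let the continuous `g`
satisfy `|g(x) - g(x₀)| ≤ L ∑ᵢ |1 - e_1(xᵢ - x₀ᵢ)|`. Then `∫ K g ≤ g(x₀) ∫ K + 2 |d| L ε ∫ K`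
(pointwise `m ≤ ε + m²/(4ε)` for `m = |1 - e_1| ≥ 0`). [folklore] -/
theorem integral_mul_le_of_windows {K g : UnitAddTorus d → ℝ} (hK : Continuous K)
    (hK0 : ∀ x, 0 ≤ K x) (hg : Continuous g) (x₀ : UnitAddTorus d) {L ε : ℝ} (hL0 : 0 ≤ L)
    (hε : 0 < ε) (hL : ∀ x, |g x - g x₀| ≤ L * ∑ i, ‖(1 : ℂ) - fourier 1 (x i - x₀ i)‖)
    (hwin : ∀ i, ∫ x, K x * (‖(1 : ℂ) - fourier 1 (x i - x₀ i)‖ ^ 2 / 4) ≤ ε ^ 2 * ∫ x, K x) :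
    ∫ x, K x * g x ≤ (g x₀ * ∫ x, K x) + 2 * Fintype.card d * L * ε * ∫ x, K x := by
  have hwin_cont : ∀ i, Continuous fun x : UnitAddTorus d => ‖(1 : ℂ) - fourier 1 (x i - x₀ i)‖ :=
    fun i => (continuous_const.sub ((fourier 1).continuous.comp
      ((continuous_apply i).sub continuous_const))).norm
  -- pointwise: `K (g - g x₀) ≤ L ∑ᵢ (ε K + K mᵢ²/(4ε))`
  have hpt : ∀ x, K x * g x - g x₀ * K x ≤
      L * ∑ i, (ε * K x + ε⁻¹ * (K x * (‖(1 : ℂ) - fourier 1 (x i - x₀ i)‖ ^ 2 / 4))) := by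
    intro x
    have h1 : K x * g x - g x₀ * K x = K x * (g x - g x₀) := by ring
    rw [h1]
    have h2 : K x * (g x - g x₀) ≤ K x * (L * ∑ i, ‖(1 : ℂ) - fourier 1 (x i - x₀ i)‖) :=
      (mul_le_mul_of_nonneg_left (le_abs_self _) (hK0 x)).trans
        (mul_le_mul_of_nonneg_left (hL x) (hK0 x))
    refine h2.trans ?_
    rw [Finset.mul_sum, Finset.mul_sum, Finset.mul_sum]
    refine Finset.sum_le_sum fun i _ => ?_
    rw [← mul_assoc, mul_comm (K x) L, mul_assoc]
    refine mul_le_mul_of_nonneg_left ?_ hL0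
    -- AM–GM: `K m ≤ ε K + K m² /(4 ε)`
    have hm : 0 ≤ ‖(1 : ℂ) - fourier 1 (x i - x₀ i)‖ := norm_nonneg _
    have hsq : 0 ≤ K x * (‖(1 : ℂ) - fourier 1 (x i - x₀ i)‖ - 2 * ε) ^ 2 / (4 * ε) := by
      have := hK0 x; positivity
    have : ε * K x + ε⁻¹ * (K x * (‖(1 : ℂ) - fourier 1 (x i - x₀ i)‖ ^ 2 / 4)) -
        K x * ‖(1 : ℂ) - fourier 1 (x i - x₀ i)‖ =
        K x * (‖(1 : ℂ) - fourier 1 (x i - x₀ i)‖ - 2 * ε) ^ 2 / (4 * ε) := by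
      field_simp; ring
    linarith
  -- integrate
  have hIK : Integrable K volume := hK.integrable_unitAddTorus
  have hwc : ∀ i, Continuous fun x : UnitAddTorus d =>
      K x * (‖(1 : ℂ) - fourier 1 (x i - x₀ i)‖ ^ 2 / 4) :=
    fun i => hK.mul (((hwin_cont i).pow 2).div_const _)
  have hIw : ∀ i, Integrable (fun x => K x * (‖(1 : ℂ) - fourier 1 (x i - x₀ i)‖ ^ 2 / 4)) volume :=
    fun i => (hwc i).integrable_unitAddTorus
  have hc1 : Continuous fun x => K x * g x - g x₀ * K x := (hK.mul hg).sub (continuous_const.mul hK)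
  have hc2 : Continuous fun x => L * ∑ i, (ε * K x + ε⁻¹ * (K x * (‖(1 : ℂ) - fourier 1 (x i - x₀ i)‖ ^ 2 / 4))) :=
    continuous_const.mul (continuous_finsetSum _ fun i _ =>
      (continuous_const.mul hK).add (continuous_const.mul (hwc i)))
  have hint : ∫ x, (K x * g x - g x₀ * K x) ≤
      ∫ x, L * ∑ i, (ε * K x + ε⁻¹ * (K x * (‖(1 : ℂ) - fourier 1 (x i - x₀ i)‖ ^ 2 / 4))) :=
    integral_mono hc1.integrable_unitAddTorus hc2.integrable_unitAddTorus hpt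
  have hIKg : Integrable (fun x => K x * g x) volume := (hK.mul hg).integrable_unitAddTorus
  have hIcK : Integrable (fun x => g x₀ * K x) volume := hIK.const_mul _
  have hl : ∫ x, (K x * g x - g x₀ * K x) = (∫ x, K x * g x) - g x₀ * ∫ x, K x := by
    rw [integral_sub hIKg hIcK, integral_const_mul]
  have hI1 : Integrable (fun x => ε * K x) volume := hIK.const_mul ε
  have hI2 : ∀ i, Integrable (fun x => ε⁻¹ * (K x * (‖(1 : ℂ) - fourier 1 (x i - x₀ i)‖ ^ 2 / 4))) volume :=
    fun i => (hIw i).const_mul _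
  have hI3 : ∀ i, Integrable (fun x => ε * K x + ε⁻¹ * (K x * (‖(1 : ℂ) - fourier 1 (x i - x₀ i)‖ ^ 2 / 4)))
      volume := fun i => hI1.add (hI2 i)
  have hr : ∫ x, L * ∑ i, (ε * K x + ε⁻¹ * (K x * (‖(1 : ℂ) - fourier 1 (x i - x₀ i)‖ ^ 2 / 4))) =
      L * ∑ i, ((ε * ∫ x, K x) + ε⁻¹ * ∫ x, K x * (‖(1 : ℂ) - fourier 1 (x i - x₀ i)‖ ^ 2 / 4)) := by
    rw [integral_const_mul, integral_finsetSum _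
      (f := fun i x => ε * K x + ε⁻¹ * (K x * (‖(1 : ℂ) - fourier 1 (x i - x₀ i)‖ ^ 2 / 4)))
      (fun i _ => hI3 i)]
    congr 1
    refine Finset.sum_congr rfl fun i _ => ?_
    rw [integral_add hI1 (hI2 i), integral_const_mul, integral_const_mul]
  rw [hl, hr] at hint
  have hsum : ∑ i, ((ε * ∫ x, K x) + ε⁻¹ * ∫ x, K x * (‖(1 : ℂ) - fourier 1 (x i - x₀ i)‖ ^ 2 / 4)) ≤
      ∑ _i : d, 2 * ε * ∫ x, K x := by
    refine Finset.sum_le_sum fun i _ => ?_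
    have h := mul_le_mul_of_nonneg_left (hwin i) (inv_nonneg.2 hε.le)
    have h' : ε⁻¹ * (ε ^ 2 * ∫ x, K x) = ε * ∫ x, K x := by field_simp
    linarith
  rw [Finset.sum_const, Finset.card_univ, nsmul_eq_mul] at hsum
  have hL' := mul_le_mul_of_nonneg_left hsum hL0
  linarith

/-! ### Polarisation -/

/-- If `|⟪η, A η⟫| ≤ s` on the unit sphere then `|⟪u, A u⟫| ≤ s ‖u‖²` everywhere. [folklore] -/
theorem inner_self_le_of_unit_bound {E : Type*} [NormedAddCommGroup E] [InnerProductSpace ℝ E]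
    (A : E →L[ℝ] E) {s : ℝ} (hA : ∀ η : E, ‖η‖ = 1 → |inner ℝ η (A η)| ≤ s) (u : E) :
    |inner ℝ u (A u)| ≤ s * ‖u‖ ^ 2 := by
  by_cases hu : u = 0
  · subst hu; simp
  · have hn : ‖u‖ ≠ 0 := norm_ne_zero_iff.2 hu
    have h1 : ‖(‖u‖⁻¹ : ℝ) • u‖ = 1 := by
      rw [norm_smul, norm_inv, norm_norm, inv_mul_cancel₀ hn]
    have h := hA _ h1
    rw [map_smul, inner_smul_left, inner_smul_right, ← mul_assoc, abs_mul] at h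
    have hpos : 0 < ‖u‖ ^ 2 := by positivity
    rw [show |((starRingEnd ℝ) ‖u‖⁻¹ * ‖u‖⁻¹)| = (‖u‖ ^ 2)⁻¹ by
      rw [abs_of_nonneg (by simp only [conj_trivial]; positivity)]; simp only [conj_trivial]; field_simp] at h
    rwa [inv_mul_le_iff₀ hpos, mul_comm] at h

/-- **Polarisation bound for the symmetric part**: if `|⟪η, A η⟫| ≤ s` on the unit sphere then
`|⟪u, A v⟫ + ⟪v, A u⟫| ≤ 2 s ‖u‖ ‖v‖`. [folklore] -/
theorem abs_inner_add_inner_le {E : Type*} [NormedAddCommGroup E] [InnerProductSpace ℝ E]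
    (A : E →L[ℝ] E) {s : ℝ} (hA : ∀ η : E, ‖η‖ = 1 → |inner ℝ η (A η)| ≤ s) (u v : E) :
    |inner ℝ u (A v) + inner ℝ v (A u)| ≤ 2 * s * ‖u‖ * ‖v‖ := by
  -- first the quadratic bound `|⟪u,Av⟫+⟪v,Au⟫| ≤ s(‖u‖²+‖v‖²)`, then rescale
  have hquad : ∀ u v : E, |inner ℝ u (A v) + inner ℝ v (A u)| ≤ s * (‖u‖ ^ 2 + ‖v‖ ^ 2) := by
    intro u v
    have hp := inner_self_le_of_unit_bound A hA (u + v)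
    have hm := inner_self_le_of_unit_bound A hA (u - v)
    have hid : inner ℝ (u + v) (A (u + v)) - inner ℝ (u - v) (A (u - v)) =
        2 * (inner ℝ u (A v) + inner ℝ v (A u)) := by
      simp only [map_add, map_sub, inner_add_left, inner_add_right, inner_sub_left, inner_sub_right]
      ring
    have hpar : ‖u + v‖ ^ 2 + ‖u - v‖ ^ 2 = 2 * (‖u‖ ^ 2 + ‖v‖ ^ 2) := by
      have := parallelogram_law_with_norm ℝ u v
      linarith
    have h2 : |2 * (inner ℝ u (A v) + inner ℝ v (A u))| ≤ s * ‖u + v‖ ^ 2 + s * ‖u - v‖ ^ 2 := by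
      rw [← hid]; exact (abs_sub _ _).trans (add_le_add hp hm)
    rw [abs_mul, abs_of_pos two_pos] at h2
    have h3 : s * ‖u + v‖ ^ 2 + s * ‖u - v‖ ^ 2 = 2 * (s * (‖u‖ ^ 2 + ‖v‖ ^ 2)) := by
      rw [← mul_add, hpar]; ring
    linarith
  by_cases hu : u = 0
  · subst hu; simp
  by_cases hv : v = 0
  · subst hv; simp
  have hnu : 0 < ‖u‖ := norm_pos_iff.2 hu
  have hnv : 0 < ‖v‖ := norm_pos_iff.2 hv
  -- apply the quadratic bound to `‖v‖ u` and `‖u‖ v`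
  have h := hquad (‖v‖ • u) (‖u‖ • v)
  rw [map_smul, map_smul, inner_smul_left, inner_smul_right, inner_smul_left, inner_smul_right,
    norm_smul, norm_smul, norm_norm, norm_norm] at h
  simp only [conj_trivial] at h
  have h' : |‖v‖ * (‖u‖ * inner ℝ u (A v)) + ‖u‖ * (‖v‖ * inner ℝ v (A u))| =
      ‖u‖ * ‖v‖ * |inner ℝ u (A v) + inner ℝ v (A u)| := by
    rw [show ‖v‖ * (‖u‖ * inner ℝ u (A v)) + ‖u‖ * (‖v‖ * inner ℝ v (A u)) =
      (‖u‖ * ‖v‖) * (inner ℝ u (A v) + inner ℝ v (A u)) by ring, abs_mul,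
      abs_of_pos (mul_pos hnu hnv)]
  rw [h'] at h
  have hprod : 0 < ‖u‖ * ‖v‖ := mul_pos hnu hnv
  have : |inner ℝ u (A v) + inner ℝ v (A u)| ≤ s * ((‖v‖ * ‖u‖) ^ 2 + (‖u‖ * ‖v‖) ^ 2) / (‖u‖ * ‖v‖) := by
    rw [le_div_iff₀ hprod]; linarith
  refine this.trans (le_of_eq ?_)
  field_simp
  ring

end Summit.AnomalousDissipation.AnomalousDissipation.Theorems
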